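import Summits.ValiantsHypothesis.ValiantsHypothesis.Theorems.GrenetZeonDualUnipotentThreeHalvesSlowCoreCoarsen
import Summits.ValiantsHypothesis.ValiantsHypothesis.Theorems.GrenetZeonDualUnipotentThreeHalvesHeavyTopCompositionBlocks

/-!
# `GrenetZeon.DualUnipotentThreeHalves` (stmt-ValiantsHypothesis-24318), line `slow_core` — glue kernel III: ★ THE MASS-CUT GLUE (invariant-subspace form)

`slow_of_longMassSlowLawInv : LongMassSlowLawInv → ∃ C₀ n₀, ∀ n ≥ n₀, ∀ m, C₀·m² < n³ → ∀ N, IsAffine N → N^m = 0 → SlowCore.Slow n m N` — the research law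
(c) of line `slow_core` (val-idea-26 g5's MASS CUT, crit-7 g3 V27 PASS), in the invariant-subspace form `LongMassSlowLawInv` (✓ `…SlowCoreLedger` §8), IMPLIES
S3 (the body of `SlowPlane`), with `C₀ = (c+18)²`.  Assembly = V27 (q3) debt (g1)–(g6): ✓ `HeavyTopCompositionBound.exists_block_conj` (composition series in
matrix clothes), class pencils + transport + nilpotency descent (✓ `…SlowCoreLedger` §6–§7), freezing + coarsening (✓ `…SlowCoreCoarsen`), (b₀) ✓
`shortMassLedger0_holds`, conjugation ✓ `ledger_top_of_conj`, and the budget.  NO Burnside ((c) keyed to `IrreducibleInv`).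
Rev 2 (§11): the EASY direction of Burnside (`irreducibleInv_of_pencilAlg_eq_top`) and `longMassSlowLaw_of_inv`
((c-Inv) ⇒ the `pencilAlg = ⊤`-keyed (c) priced by crit-7 g3 V27).
Honest framing.  A CONDITIONAL reduction (`--supports stmt-ValiantsHypothesis-24318`): (c) `LongMassSlowLawInv` is a RESEARCH statement, NOT proved; S3, the
crux 24318, 8062, `VP ≠ VNP` are OPEN / NOT proved.  No definitions, no named facts.  (Inlined as PART A of `Cruxes/…/Lines/slow_core.lean` rev 3 @3b0d486a3202.)
-/

-- single-conjunct layout: Sub = Summit, duplicated namespace component intended (the name is mandated)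
set_option linter.dupNamespace false
set_option autoImplicit false

noncomputable section

namespace Summit.ValiantsHypothesis.ValiantsHypothesis.Theorems.GrenetZeon.SlowCore

open MvPolynomial Matrix
open scoped BigOperators
open Summit.ValiantsHypothesis.ValiantsHypothesis.Cruxes.TwoDimCoefficients.DimTwoCases (AffMat IsAffine)
open Summit.ValiantsHypothesis.ValiantsHypothesis.Theorems.GrenetZeon.RadicalSplit (lineSubst pencilAlg)

/-! ## §10 THE GLUE: (b₀) + (c) in invariant-subspace form ⇒ S3 (`SlowCore.Slow` for every regime pencil) -/

section Glue

variable {n m : ℕ}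

/-- Values of a constant conjugate of a pencil. -/
theorem conj_map_eval (N : AffMat n m) (P Q : Matrix (Fin m) (Fin m) ℂ) (x : Fin n × Fin n → ℂ) :
    (P.map C * N * Q.map C).map (MvPolynomial.eval x) = P * N.map (MvPolynomial.eval x) * Q := by
  rw [show ∀ A : AffMat n m, A.map (MvPolynomial.eval x) = (MvPolynomial.eval x).mapMatrix A from fun _ => rfl, map_mul, map_mul]
  simp only [RingHom.mapMatrix_apply]
  congr 1
  · congr 1
    ext i j; simp only [Matrix.map_apply, MvPolynomial.eval_C]
  · ext i j; simp only [Matrix.map_apply, MvPolynomial.eval_C]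

/-- Nilpotency is conjugation-invariant. -/
theorem conj_pow_eq_zero (N : AffMat n m) (G G' : Matrix (Fin m) (Fin m) ℂ) (hGG : G' * G = 1) (hGG' : G * G' = 1) {h : ℕ}
    (hN : N ^ h = 0) : (G.map C * N * G'.map C) ^ h = 0 := by
  have hc : ∀ A B : Matrix (Fin m) (Fin m) ℂ, A * B = 1 →
      A.map (C : ℂ → MvPolynomial (Fin n × Fin n) ℂ) * B.map C = 1 := by
    intro A B hAB
    rw [show A.map (C : ℂ → MvPolynomial (Fin n × Fin n) ℂ) = (C : ℂ →+* _).mapMatrix A from rfl,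
      show B.map (C : ℂ → MvPolynomial (Fin n × Fin n) ℂ) = (C : ℂ →+* _).mapMatrix B from rfl, ← map_mul, hAB, map_one]
  have h1 := Summit.ValiantsHypothesis.ValiantsHypothesis.Theorems.GrenetZeon.FlagCost.conj_pow_eq (G.map C) (G'.map C) N (hc G' G hGG) h
  calc (G.map C * N * G'.map C) ^ h
      = (G.map C * G'.map C) * (G.map C * N * G'.map C) ^ h * (G.map C * G'.map C) := by rw [hc G G' hGG', Matrix.one_mul, Matrix.mul_one]
    _ = G.map C * (G'.map C * (G.map C * N * G'.map C) ^ h * G.map C) * G'.map C := by simp only [Matrix.mul_assoc]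
    _ = 0 := by rw [h1, hN, Matrix.mul_zero, Matrix.zero_mul]

/-- A pencil all of whose VALUES are level-cut is level-cut (polynomial identity from all evaluations, `ℂ` infinite). -/
theorem levelCut_of_values (N' : AffMat n m) (lvl : Fin m → ℕ)
    (h : ∀ (x : Fin n × Fin n → ℂ) (i j : Fin m), lvl i < lvl j → (N'.map (MvPolynomial.eval x)) i j = 0) : LevelCut N' lvl := by
  intro i j hij
  refine MvPolynomial.funext fun x => ?_
  rw [map_zero]
  have h1 := h x i j hij
  rwa [Matrix.map_apply] at h1

/-- The regime in square-root form: `C₀·m² < n³` with `C₀ = a²` gives `a·m < n·(√n + 1)`. -/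
theorem regime_sqrt {a n m : ℕ} (hreg : a ^ 2 * m ^ 2 < n ^ 3) : a * m < n * (Nat.sqrt n + 1) := by
  have hnT : n < (Nat.sqrt n + 1) * (Nat.sqrt n + 1) := Nat.lt_succ_sqrt n
  have hn : 0 < n := by
    rcases Nat.eq_zero_or_pos n with h0 | h0
    · subst h0; simp at hreg
    · exact h0
  have h1 : (a * m) * (a * m) < (n * (Nat.sqrt n + 1)) * (n * (Nat.sqrt n + 1)) := by
    calc (a * m) * (a * m) = a ^ 2 * m ^ 2 := by ring
      _ < n ^ 3 := hreg
      _ = (n * n) * n := by ring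
      _ < (n * n) * ((Nat.sqrt n + 1) * (Nat.sqrt n + 1)) := Nat.mul_lt_mul_of_pos_left hnT (Nat.mul_pos hn hn)
      _ = (n * (Nat.sqrt n + 1)) * (n * (Nat.sqrt n + 1)) := by ring
  exact Nat.mul_self_lt_mul_self_iff.1 h1

open Summit.ValiantsHypothesis.ValiantsHypothesis.Theorems.GrenetZeon.HeavyTopCompositionBound (exists_block_conj) in
/-- ★ **THE MASS-CUT GLUE, invariant-subspace form**: (c) `LongMassSlowLawInv` ⇒ S3 (the body of `SlowPlane`: every affine nilpotent pencil of the regime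
`(c+18)²·m² < n³`, `n ≥ max n₀ 2`, is `Slow`).  Assembly (crit-7 g3 V27 (q3), val-idea-26 g5 `MassCut.lean` header): SMALL `m` (`3m < n`): freeze everything
(`codim ≤ m²`, `k = 0`).  Otherwise: composition series in matrix clothes ✓ `exists_block_conj` (constant conjugation `N' = P·N·P⁻¹`, level cut, IRREDUCIBLE
diagonal blocks), nilpotency descends to the class pencils (`classPencil_pow_eq_zero`, `pow_card_eq_zero_of_pow_eq_zero`), (c) prices every BIG class
(`size ≥ √n + 1`) at `c·√n·size` and (g4) transports it to a class ledger (`ledger_class_of_classPencil`); the levels are COARSENED (`coarsen`, threshold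
`T = √n + 1`): runs of small levels in one window of cumulative size merge into classes of size `< 2T` (`card_small_class_lt`), which are FROZEN
(`freezeSpace`, codim `≤ 2T·m`, class ledger `0` by `ledger_class_of_frozen`); the common `K` = freeze space ⊓ the big classes' spaces (codims add,
`codim_finset_inf_le`); (b₀) ✓ `shortMassLedger0_holds` stacks the `≤ 2(m/T) + 2` classes; (g3) `ledger_top_of_conj` returns to `N`; the budget closes by
`(c+18)·m < n(√n+1)` and `n ≤ 3m`.  NO Burnside needed in this form. -/
theorem slow_of_longMassSlowLawInv (hc : LongMassSlowLawInv) :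
    ∃ C₀ n₀ : ℕ, ∀ n ≥ n₀, ∀ m : ℕ, C₀ * m ^ 2 < n ^ 3 → ∀ N : AffMat n m, IsAffine N → N ^ m = 0 → Slow n m N := by
  classical
  obtain ⟨c, n₀, hc⟩ := hc
  refine ⟨(c + 18) ^ 2, max n₀ 2, fun n hn m hreg N hN hnil => ?_⟩
  have hn₀ : n₀ ≤ n := le_trans (le_max_left _ _) hn
  have hn2 : 2 ≤ n := le_trans (le_max_right _ _) hn
  set s := Nat.sqrt n with hs
  have hs1 : 1 ≤ s := Nat.le_sqrt.2 (by omega)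
  have hss : s * s ≤ n := Nat.sqrt_le n
  have hnT : n < (s + 1) * (s + 1) := Nat.lt_succ_sqrt n
  have hreg' : (c + 18) * m < n * (s + 1) := regime_sqrt hreg
  by_cases hsmall : 3 * m < n
  · -- SMALL m: freeze everything
    set K0 : Submodule ℂ (Fin n × Fin n → ℂ) := freezeSpace N (Finset.univ : Finset (Fin m × Fin m)) with hK0
    have hfr : Freezes N (fun i j => (fun _ : Fin m => 0) i = 0 ∧ (fun _ : Fin m => 0) j = 0) K0 :=
      fun i j _ v hv => linEntry_eq_zero_of_mem_freezeSpace N _ (Finset.mem_univ (i, j)) hv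
    have hcut0 : LevelCut N (fun _ => 0) := fun i j h => absurd h (lt_irrefl _)
    have hL0 := ledger_class_of_frozen N hN hcut0 0 hfr
    have htop0 : Ledger n m N (fun _ => True) K0 0 := ledger_mono hL0 (fun _ _ => rfl) le_rfl le_rfl
    refine slow_of_slowR (slowR_of_ledger htop0 ?_)
    have hcod := codim_freezeSpace_le N (Finset.univ : Finset (Fin m × Fin m))
    rw [Finset.card_univ, Fintype.card_prod, Fintype.card_fin, ← hK0] at hcod
    have h9 : 9 * (m * m) < n * n := by nlinarith
    have h10 : 2 * n ≤ n * n := Nat.mul_le_mul_right n hn2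
    have hK0le := finrank_dir_le n K0
    omega
  · -- LARGE m (n ≤ 3m): composition series, (c) on big classes, freeze the merged small runs, stack
    push Not at hsmall
    have hm1 : 1 ≤ m := by omega
    obtain ⟨P, L, lvl, hlvl, _hLm, _hne, hblock, hirr⟩ :=
      exists_block_conj (Set.range fun x : Fin n × Fin n → ℂ => N.map (MvPolynomial.eval x))
    set G : Matrix (Fin m) (Fin m) ℂ := (P : Matrix (Fin m) (Fin m) ℂ) with hG
    set G' : Matrix (Fin m) (Fin m) ℂ := (↑P⁻¹ : Matrix (Fin m) (Fin m) ℂ) with hG'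
    have hGG : G' * G = 1 := Units.inv_mul P
    have hGG' : G * G' = 1 := Units.mul_inv P
    set N' : AffMat n m := G.map C * N * G'.map C with hN'def
    have hN'aff : IsAffine N' := isAffine_conj N hN G G'
    have hN'nil : N' ^ m = 0 := conj_pow_eq_zero N G G' hGG hGG' hnil
    have hcut : LevelCut N' lvl :=
      levelCut_of_values N' lvl fun x i j hij => by rw [hN'def, conj_map_eval]; exact hblock _ ⟨x, rfl⟩ i j hij
    -- threshold and coarsening
    set T : ℕ := s + 1 with hTdef
    have hT : 0 < T := Nat.succ_pos s
    set lvl' : Fin m → ℕ := fun i => coarsen lvl T (lvl i) with hlvl'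
    have hcut' : LevelCut N' lvl' := levelCut_mono hcut (coarsen lvl T) (coarsen_mono lvl hT)
    set P' : ℕ := 2 * (m / T) + 2 with hP'def
    have hP' : ∀ i, lvl' i < P' := fun i => coarsen_lt lvl T (lvl i)
    -- (c) on the big levels, transported to class ledgers of N'
    have hbig : ∀ t : ℕ, ∃ (K : Submodule ℂ (Fin n × Fin n → ℂ)) (k : ℕ), t < L → T ≤ lvlSize lvl t →
        Ledger n m N' (fun i => lvl i = t) K k ∧ n * k + (n * n - Module.finrank ℂ K) ≤ c * (s * lvlSize lvl t) := by
      intro t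
      by_cases ht : t < L ∧ T ≤ lvlSize lvl t
      · obtain ⟨htL, htb⟩ := ht
        have hcardt : Fintype.card {i : Fin m // lvl i = t} = lvlSize lvl t := by rw [Fintype.card_subtype]; rfl
        let e : {i : Fin m // lvl i = t} ≃ Fin (lvlSize lvl t) := Fintype.equivFinOfCardEq hcardt
        obtain ⟨K, k, hK, hprice⟩ := hc n hn₀ (lvlSize lvl t) (classPencil N' e) (isAffine_classPencil N' hN'aff e)
          (pow_card_eq_zero_of_pow_eq_zero _ (classPencil_pow_eq_zero N' hcut e hN'nil))
          (irreducibleInv_classPencil N G G' e (hirr t htL _ e))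
        exact ⟨K, k, fun _ _ => ⟨ledger_class_of_classPencil N' hcut e hK, hprice⟩⟩
      · exact ⟨⊤, 0, fun h1 h2 => absurd ⟨h1, h2⟩ ht⟩
    choose Kt kt hKt using hbig
    -- the freezing set: pairs of small-level coordinates in one merged class
    let Rrel : Fin m → Fin m → Prop := fun i j => lvlSize lvl (lvl i) < T ∧ lvlSize lvl (lvl j) < T ∧ lvl' i = lvl' j
    set R : Finset (Fin m × Fin m) := Finset.univ.filter fun ij => Rrel ij.1 ij.2 with hRdef
    have hRcard : R.card ≤ m * (2 * T) := by
      refine card_filter_prod_le Rrel fun i => ?_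
      by_cases hi : lvlSize lvl (lvl i) < T
      · refine le_of_lt (lt_of_le_of_lt (Finset.card_le_card fun j hj => ?_) (card_small_class_lt lvl hT (lvl' i)))
        simp only [Finset.mem_filter, Finset.mem_univ, true_and, Rrel] at hj ⊢
        exact ⟨hj.2.1, hj.2.2.symm⟩
      · have h0 : (Finset.univ.filter fun j => Rrel i j) = ∅ :=
          Finset.filter_false_of_mem fun j _ h => hi h.1
        rw [h0, Finset.card_empty]; exact Nat.zero_le _
    set bigS : Finset ℕ := (Finset.range L).filter fun t => T ≤ lvlSize lvl t with hbigS
    set K : Submodule ℂ (Fin n × Fin n → ℂ) := freezeSpace N' R ⊓ bigS.inf Kt with hKdef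
    set kb : ℕ → ℕ := fun q => ∑ t ∈ bigS.filter (fun t => coarsen lvl T t = q), kt t with hkbdef
    -- the class ledgers of the merged classes
    have hclass : ∀ q, q < P' → Ledger n m N' (fun i => lvl' i = q) K (kb q) := by
      intro q _
      by_cases hq : ∃ t ∈ bigS, coarsen lvl T t = q
      · obtain ⟨t, htS, htq⟩ := hq
        have htL : t < L := Finset.mem_range.1 (Finset.mem_filter.1 htS).1
        have htb : T ≤ lvlSize lvl t := (Finset.mem_filter.1 htS).2
        refine ledger_mono (hKt t htL htb).1 (fun i hi => ?_) (inf_le_right.trans (Finset.inf_le htS)) ?_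
        · exact eq_of_coarsen_eq_of_big lvl hT htb (by rw [htq]; exact hi)
        · exact Finset.single_le_sum (f := kt) (fun _ _ => Nat.zero_le _) (Finset.mem_filter.2 ⟨htS, htq⟩)
      · push Not at hq
        have hsm : ∀ i, lvl' i = q → lvlSize lvl (lvl i) < T := fun i hi => by
          by_contra hb
          exact hq (lvl i) (Finset.mem_filter.2 ⟨Finset.mem_range.2 (hlvl i), not_lt.1 hb⟩) hi
        have hfr : Freezes N' (fun i j => lvl' i = q ∧ lvl' j = q) K := by
          intro i j hij v hv
          have hmem : (i, j) ∈ R :=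
            Finset.mem_filter.2 ⟨Finset.mem_univ _, hsm i hij.1, hsm j hij.2, hij.1.trans hij.2.symm⟩
          exact linEntry_eq_zero_of_mem_freezeSpace N' R hmem (inf_le_left (b := bigS.inf Kt) hv)
        exact ledger_mono (ledger_class_of_frozen N' hN'aff hcut' q hfr) (fun _ h => h) le_rfl (Nat.zero_le _)
    -- (b₀): stack the classes; (g3): back to N
    have htop : Ledger n m N' (fun _ => True) K ((∑ q ∈ Finset.range P', kb q) + (P' - 1)) :=
      shortMassLedger0_holds n m P' N' hN'aff lvl' hP' hcut' K kb hclass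
    have htopN := ledger_top_of_conj N N' G G' hGG rfl htop
    refine slow_of_slowR (slowR_of_ledger htopN ?_)
    -- BUDGET
    have hsumk : ∑ q ∈ Finset.range P', kb q = ∑ t ∈ bigS, kt t :=
      Finset.sum_fiberwise_of_maps_to (fun t _ => Finset.mem_range.2 (coarsen_lt lvl T t)) kt
    have hprice : n * (∑ t ∈ bigS, kt t) + ∑ t ∈ bigS, (n * n - Module.finrank ℂ (Kt t)) ≤ c * (s * m) := by
      have h1 : ∀ t ∈ bigS, n * kt t + (n * n - Module.finrank ℂ (Kt t)) ≤ c * (s * lvlSize lvl t) := fun t ht =>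
        (hKt t (Finset.mem_range.1 (Finset.mem_filter.1 ht).1) (Finset.mem_filter.1 ht).2).2
      calc n * (∑ t ∈ bigS, kt t) + ∑ t ∈ bigS, (n * n - Module.finrank ℂ (Kt t))
          = ∑ t ∈ bigS, (n * kt t + (n * n - Module.finrank ℂ (Kt t))) := by rw [Finset.mul_sum, ← Finset.sum_add_distrib]
        _ ≤ ∑ t ∈ bigS, c * (s * lvlSize lvl t) := Finset.sum_le_sum h1
        _ = c * (s * ∑ t ∈ bigS, lvlSize lvl t) := by rw [Finset.mul_sum, Finset.mul_sum]
        _ ≤ c * (s * ∑ t ∈ Finset.range L, lvlSize lvl t) :=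
          Nat.mul_le_mul_left _ (Nat.mul_le_mul_left _ (Finset.sum_le_sum_of_subset (Finset.filter_subset _ _)))
        _ = c * (s * m) := by rw [sum_lvlSize_eq lvl hlvl]
    have hcodim : n * n - Module.finrank ℂ K ≤ R.card + ∑ t ∈ bigS, (n * n - Module.finrank ℂ (Kt t)) :=
      (codim_inf_le _ _).trans (add_le_add (codim_freezeSpace_le N' R) (codim_finset_inf_le bigS Kt))
    have hKle := finrank_dir_le n K
    have hPn : (m / T) * n ≤ m * T :=
      calc (m / T) * n ≤ (m / T) * (T * T) := Nat.mul_le_mul_left _ hnT.le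
        _ = (m / T * T) * T := by ring
        _ ≤ m * T := Nat.mul_le_mul_right _ (Nat.div_mul_le_self m T)
    have hcs : c * (s * m) + 18 * (m * s) ≤ n * n + n * s := by
      have h1 : (c + 18) * m * s ≤ n * (s + 1) * s := Nat.mul_le_mul_right _ hreg'.le
      nlinarith
    have hns : n * s ≤ 3 * (m * s) := by nlinarith
    have hms : m ≤ m * s := Nat.le_mul_of_pos_right m hs1
    have hexp : (∑ t ∈ bigS, kt t + (P' - 1) + 1) * n = n * ∑ t ∈ bigS, kt t + 2 * ((m / T) * n) + 2 * n := by
      have h1 : ∑ t ∈ bigS, kt t + (P' - 1) + 1 = ∑ t ∈ bigS, kt t + P' := by omega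
      rw [h1, hP'def]; ring
    rw [hsumk]
    have hmT : m * T = m * s + m := by rw [hTdef]; ring
    have hR2 : m * (2 * T) = 2 * (m * s) + 2 * m := by rw [hTdef]; ring
    omega

end Glue


/-! ## §11 The easy direction of Burnside: `pencilAlg B = ⊤` ⇒ `IrreducibleInv B`; so the Inv-keyed law (c) implies the `pencilAlg`-keyed one -/

section EasyBurnside

variable {n b : ℕ}

/-- A subspace invariant under all VALUES of the pencil is invariant under the whole pencil algebra. -/
theorem mulVec_mem_of_mem_pencilAlg (B : AffMat n b) (V : Submodule ℂ (Fin b → ℂ))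
    (hV : ∀ x : Fin n × Fin n → ℂ, ∀ w ∈ V, (B.map (MvPolynomial.eval x)) *ᵥ w ∈ V)
    {A : Matrix (Fin b) (Fin b) ℂ} (hA : A ∈ pencilAlg B) : ∀ w ∈ V, A *ᵥ w ∈ V := by
  refine Algebra.adjoin_induction (p := fun A _ => ∀ w ∈ V, A *ᵥ w ∈ V) ?_ ?_ ?_ ?_ hA
  · rintro _ ⟨x, rfl⟩ w hw
    exact hV x w hw
  · intro r w hw
    rw [Algebra.algebraMap_eq_smul_one, Matrix.smul_mulVec, Matrix.one_mulVec]
    exact V.smul_mem r hw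
  · intro A A' _ _ hA hA' w hw
    rw [Matrix.add_mulVec]
    exact V.add_mem (hA w hw) (hA' w hw)
  · intro A A' _ _ hA hA' w hw
    rw [← Matrix.mulVec_mulVec]
    exact hA _ (hA' w hw)

/-- **Easy Burnside**: an irreducible pencil in the algebra sense (`pencilAlg B = ⊤`) has no common invariant subspace of its values. -/
theorem irreducibleInv_of_pencilAlg_eq_top (B : AffMat n b) (htop : pencilAlg B = ⊤) : IrreducibleInv B := by
  classical
  intro V hV
  have hall : ∀ A : Matrix (Fin b) (Fin b) ℂ, ∀ w ∈ V, A *ᵥ w ∈ V := fun A =>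
    mulVec_mem_of_mem_pencilAlg B V hV (by rw [htop]; exact Algebra.mem_top)
  by_cases hbot : V = ⊥
  · exact Or.inl hbot
  · right
    obtain ⟨w, hwV, hw0⟩ := (Submodule.ne_bot_iff V).1 hbot
    obtain ⟨j, hj⟩ : ∃ j, w j ≠ 0 := by
      by_contra h
      push Not at h
      exact hw0 (funext h)
    refine Submodule.eq_top_iff'.2 fun u => ?_
    have hAu : (Matrix.of fun i k => if k = j then u i * (w j)⁻¹ else 0) *ᵥ w = u := by
      ext i
      simp [Matrix.mulVec, dotProduct, ite_mul, Finset.sum_ite_eq', inv_mul_cancel_right₀ hj]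
    rw [← hAu]
    exact hall _ w hwV

/-- **(c-Inv) ⇒ (c)**: the invariant-subspace-keyed long-mass law implies the `pencilAlg = ⊤`-keyed one (the form priced by crit-7 g3 V27; spelled out,
= `SlowCoreLine.LongMassSlowLaw` / `MassCut.LongMassSlowLaw`).  The converse is Burnside's theorem (not needed by the line). -/
theorem longMassSlowLaw_of_inv (h : LongMassSlowLawInv) :
    ∃ c n₀ : ℕ, ∀ n ≥ n₀, ∀ b : ℕ, ∀ B : AffMat n b, IsAffine B → B ^ b = 0 → pencilAlg B = ⊤ →
      RelCert n b B (c * (Nat.sqrt n * b)) := by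
  obtain ⟨c, n₀, h⟩ := h
  exact ⟨c, n₀, fun n hn b B hB hnil htop => h n hn b B hB hnil (irreducibleInv_of_pencilAlg_eq_top B htop)⟩

end EasyBurnside

end Summit.ValiantsHypothesis.ValiantsHypothesis.Theorems.GrenetZeon.SlowCore
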